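import Summits.KontsevichZagierPeriods.KontsevichZagierPeriods.Theorems.HurwitzMicroSectorsNormalFormPrincipleM4RelDilations4
import Summits.KontsevichZagierPeriods.KontsevichZagierPeriods.Theorems.HurwitzMicroSectorsNormalFormPrincipleM4RelPdil4
import Summits.KontsevichZagierPeriods.KontsevichZagierPeriods.Theorems.HurwitzMicroSectorsNormalFormPrincipleM4RelShuffles4
import Summits.KontsevichZagierPeriods.KontsevichZagierPeriods.Theorems.HurwitzMicroSectorsNormalFormPrincipleM4RelBstuffle13m
import Summits.KontsevichZagierPeriods.KontsevichZagierPeriods.Theorems.HurwitzMicroSectorsNormalFormPrincipleM4SharedTools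
import Summits.KontsevichZagierPeriods.KontsevichZagierPeriods.Theorems.HurwitzMicroSectorsNormalFormPrincipleM4RelBstuffle13p
import Summits.KontsevichZagierPeriods.KontsevichZagierPeriods.Theorems.HurwitzMicroSectorsNormalFormPrincipleM4RelBstuffle22pm
import Summits.KontsevichZagierPeriods.KontsevichZagierPeriods.Theorems.HurwitzMicroSectorsNormalFormPrincipleM4RelBstuffle22pp
import Summits.KontsevichZagierPeriods.KontsevichZagierPeriods.Theorems.HurwitzMicroSectorsNormalFormPrincipleM4ExistsWordRep4
import Summits.KontsevichZagierPeriods.KontsevichZagierPeriods.Theorems.HurwitzMicroSectorsNormalFormPrincipleM4BoxSubSimplex4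
import Summits.KontsevichZagierPeriods.KontsevichZagierPeriods.Theorems.HurwitzMicroSectorsNormalFormPrincipleM4LogTimesNegZetaThree
import Summits.KontsevichZagierPeriods.KontsevichZagierPeriods.Theorems.HurwitzMicroSectorsNormalFormPrincipleL2W3Carriers
import Summits.KontsevichZagierPeriods.KontsevichZagierPeriods.Theorems.MzvKernelInKZ.Negative.ScalingDivision
import Summits.KontsevichZagierPeriods.KontsevichZagierPeriods.Theorems.HyperbolicBlochOffTetraSectorKernelStubAffineOrbit
import Literature.NumberTheory.Transcendental.KZSubcalculusInvariants

/-!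
# `NormalFormPrinciple` (stmt-KontsevichZagierPeriods-3869), line `SketchIdeator1` —
# leaf `stub_boxRigidity`, layer `M4`: the first STUFFLE instance, `2η(4) = ζ(4) + ζ(2,2)`

Pure proof file (registered sub-goal `m4_twoEtaFour`, lead seat c9; `--supports` the crux). A
transcendence-free equal-value pair of RATIONAL four-dimensional boxes settled by a chain of
Kontsevich–Zagier moves:

  `2·[□⁴, 1/(1 + x₀x₁x₂x₃)] ∼ [□⁴, 1/((1 − x₀x₁)(1 − x₀x₁x₂x₃))]`   (common value `(7/4)ζ(4)`).

After the cubical chart (rule (2), `m4_box_sub_simplex4`) the two sides are the words `2[aaac]` and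
`[aaab] + [abab]` on the decreasing simplex `Δ₄` (`a = dt/t`, `b = dt/(1−t)`, `c = dt/(1+t)`), and
`12·(2[aaac] − [aaab] − [abab])` is an INTEGER combination of thirteen landed relations of the
calculus — three dilations (`m4_rel_dilations4`), four shuffles (`m4_rel_shuffles4`), two partial
dilations in the product ideal (`m4_rel_pdil4`) and four STUFFLES, each realised as one
integrand-additivity move on a product box (three-term partial fraction) plus a coordinate
permutation and cubical charts (`m4_rel_bstuffle13p/13m/22pm/22pp`):

  `12·(2[aaac] − [aaab] − [abab]) = −24·bst13p + 24·bst13m + 16·bst22pm − 20·bst22pp − 12·dil_aabb`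
  ` − 2·dil_abab − 24·sh_ab_ac − 24·sh_aab_c + 8·dil_aaab + 24·sh_aac_c + 9·sh_ab_ab + 9·pdil_ab_ab + 10·pdil_ab_ac`

(exact certificate found by linear algebra over `ℚ` on the 36 words and 22 products of weight four,
`Cruxes/NormalFormPrinciple/Lines/SketchIdeator1-leaf-m3.md` §6). The factor `12` is divided out by
the scaling move (`MzvKernelInKZ.Negative.mem_relations_of_nsmul_mem`). This is the first instance
of the leaf in the tree whose chain of moves passes through a quasi-shuffle.
References: M. Kontsevich, D. Zagier, *Periods* (2001), §1.2 rules (1), (2), §4.1; M. E. Hoffman,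
*The algebra of multiple harmonic series*, J. Algebra 194 (1997); K. Ihara, M. Kaneko, D. Zagier,
Compos. Math. 142 (2006), §1. No definitions are introduced.
-/

noncomputable section

open MeasureTheory Set
open Literature.NumberTheory.Transcendental Literature.NumberTheory.Transcendental.KZ
open Literature.ModelTheory.ExponentialFields (IsSemialgebraic)
open Summit.KontsevichZagierPeriods.HyperbolicBloch.OffTetraSectorKernel
  (aff_orbit_of_sub_sum_zsmul_mem_relations)

namespace Summit.KontsevichZagierPeriods.HurwitzMicroSectors.NormalFormPrinciple.PiBox.M3

/-- **The first dimension-four stuffle instance of the leaf** (lead seat c9, line `SketchIdeator1`,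
layer `M4`). `2[□⁴, 1/(1 + x₀x₁x₂x₃)] ∼ [□⁴, 1/((1 − x₀x₁)(1 − x₀x₁x₂x₃))]`
(`2η(4) = ζ(4) + ζ(2,2)`): a chain of Kontsevich–Zagier moves through the thirteen relations of the
certificate (three dilations, four shuffles, two partial dilations in the product ideal, four
box-stuffles) and the two cubical charts of the sides, with integer clearing by `12`.
[cite: KontsevichZagier2001, §1.2 rules (1), (2); §4.1] -/
theorem m4_twoEtaFour :
    ∀ (r r' : IntegralRep 4), r.domain = {x | ∀ i, x i ∈ Set.Ioo (0:ℝ) 1} →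
      EqOn r.integrand (fun x => 2 / (1 + x 0 * x 1 * x 2 * x 3)) r.domain →
      r'.domain = {x | ∀ i, x i ∈ Set.Ioo (0:ℝ) 1} →
      EqOn r'.integrand (fun x => 1 / ((1 - x 0 * x 1) * (1 - x 0 * x 1 * x 2 * x 3))) r'.domain →
      Equivalent r r' := by
  intro r r' hrd hri hr'd hr'i
  -- carriers: the interval, the Δ₂ and Δ₃ words, the twelve Δ₄ words
  obtain ⟨C1, hC1d, hC1i⟩ := m4b_exists_logBox
  obtain ⟨AB, hABd, hABi⟩ : ∃ T : IntegralRep 2, T.domain = {t | 0 < t 1 ∧ t 1 < t 0 ∧ t 0 < 1} ∧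
      (T.integrand = fun t => 1 / t 0 * (1 / (1 - t 1))) :=
    m4t_exists_wordRep2 (fun u => 1 / u) (fun u => 1 / (1 - u)) (Or.inl rfl) (Or.inl rfl)
  obtain ⟨AC, hACd, hACi⟩ : ∃ T : IntegralRep 2, T.domain = {t | 0 < t 1 ∧ t 1 < t 0 ∧ t 0 < 1} ∧
      (T.integrand = fun t => 1 / t 0 * (1 / (1 + t 1))) :=
    m4t_exists_wordRep2 (fun u => 1 / u) (fun u => 1 / (1 + u)) (Or.inl rfl) (Or.inr rfl)
  obtain ⟨AAB, -, AAC, -, -, -, -, -, -, -, -, -, -, -, -, -, ⟨hAABd, hAABi⟩, -, ⟨hAACd, hAACi⟩, -⟩ :=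
    l2w3_carriers
  obtain ⟨AAAB, hAAABd, hAAABi⟩ : ∃ T : IntegralRep 4, T.domain = {t | 0 < t 3 ∧ t 3 < t 2 ∧ t 2 < t 1 ∧ t 1 < t 0 ∧ t 0 < 1} ∧
      (T.integrand = fun t => 1 / t 0 * (1 / t 1) * (1 / t 2) * (1 / (1 - t 3))) :=
    m4_exists_wordRep4 (fun u => 1 / u) (fun u => 1 / u) (fun u => 1 / u) (fun u => 1 / (1 - u)) (Or.inl rfl) (Or.inl rfl) (Or.inl rfl) (Or.inl rfl)
  obtain ⟨AAAC, hAAACd, hAAACi⟩ : ∃ T : IntegralRep 4, T.domain = {t | 0 < t 3 ∧ t 3 < t 2 ∧ t 2 < t 1 ∧ t 1 < t 0 ∧ t 0 < 1} ∧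
      (T.integrand = fun t => 1 / t 0 * (1 / t 1) * (1 / t 2) * (1 / (1 + t 3))) :=
    m4_exists_wordRep4 (fun u => 1 / u) (fun u => 1 / u) (fun u => 1 / u) (fun u => 1 / (1 + u)) (Or.inl rfl) (Or.inl rfl) (Or.inl rfl) (Or.inr rfl)
  obtain ⟨AABB, hAABBd, hAABBi⟩ : ∃ T : IntegralRep 4, T.domain = {t | 0 < t 3 ∧ t 3 < t 2 ∧ t 2 < t 1 ∧ t 1 < t 0 ∧ t 0 < 1} ∧
      (T.integrand = fun t => 1 / t 0 * (1 / t 1) * (1 / (1 - t 2)) * (1 / (1 - t 3))) :=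
    m4_exists_wordRep4 (fun u => 1 / u) (fun u => 1 / u) (fun u => 1 / (1 - u)) (fun u => 1 / (1 - u)) (Or.inl rfl) (Or.inl rfl) (Or.inr (Or.inl rfl)) (Or.inl rfl)
  obtain ⟨AABC, hAABCd, hAABCi⟩ : ∃ T : IntegralRep 4, T.domain = {t | 0 < t 3 ∧ t 3 < t 2 ∧ t 2 < t 1 ∧ t 1 < t 0 ∧ t 0 < 1} ∧
      (T.integrand = fun t => 1 / t 0 * (1 / t 1) * (1 / (1 - t 2)) * (1 / (1 + t 3))) :=
    m4_exists_wordRep4 (fun u => 1 / u) (fun u => 1 / u) (fun u => 1 / (1 - u)) (fun u => 1 / (1 + u)) (Or.inl rfl) (Or.inl rfl) (Or.inr (Or.inl rfl)) (Or.inr rfl)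
  obtain ⟨AACB, hAACBd, hAACBi⟩ : ∃ T : IntegralRep 4, T.domain = {t | 0 < t 3 ∧ t 3 < t 2 ∧ t 2 < t 1 ∧ t 1 < t 0 ∧ t 0 < 1} ∧
      (T.integrand = fun t => 1 / t 0 * (1 / t 1) * (1 / (1 + t 2)) * (1 / (1 - t 3))) :=
    m4_exists_wordRep4 (fun u => 1 / u) (fun u => 1 / u) (fun u => 1 / (1 + u)) (fun u => 1 / (1 - u)) (Or.inl rfl) (Or.inl rfl) (Or.inr (Or.inr rfl)) (Or.inl rfl)
  obtain ⟨AACC, hAACCd, hAACCi⟩ : ∃ T : IntegralRep 4, T.domain = {t | 0 < t 3 ∧ t 3 < t 2 ∧ t 2 < t 1 ∧ t 1 < t 0 ∧ t 0 < 1} ∧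
      (T.integrand = fun t => 1 / t 0 * (1 / t 1) * (1 / (1 + t 2)) * (1 / (1 + t 3))) :=
    m4_exists_wordRep4 (fun u => 1 / u) (fun u => 1 / u) (fun u => 1 / (1 + u)) (fun u => 1 / (1 + u)) (Or.inl rfl) (Or.inl rfl) (Or.inr (Or.inr rfl)) (Or.inr rfl)
  obtain ⟨ABAB, hABABd, hABABi⟩ : ∃ T : IntegralRep 4, T.domain = {t | 0 < t 3 ∧ t 3 < t 2 ∧ t 2 < t 1 ∧ t 1 < t 0 ∧ t 0 < 1} ∧
      (T.integrand = fun t => 1 / t 0 * (1 / (1 - t 1)) * (1 / t 2) * (1 / (1 - t 3))) :=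
    m4_exists_wordRep4 (fun u => 1 / u) (fun u => 1 / (1 - u)) (fun u => 1 / u) (fun u => 1 / (1 - u)) (Or.inl rfl) (Or.inr (Or.inl rfl)) (Or.inl rfl) (Or.inl rfl)
  obtain ⟨ABAC, hABACd, hABACi⟩ : ∃ T : IntegralRep 4, T.domain = {t | 0 < t 3 ∧ t 3 < t 2 ∧ t 2 < t 1 ∧ t 1 < t 0 ∧ t 0 < 1} ∧
      (T.integrand = fun t => 1 / t 0 * (1 / (1 - t 1)) * (1 / t 2) * (1 / (1 + t 3))) :=
    m4_exists_wordRep4 (fun u => 1 / u) (fun u => 1 / (1 - u)) (fun u => 1 / u) (fun u => 1 / (1 + u)) (Or.inl rfl) (Or.inr (Or.inl rfl)) (Or.inl rfl) (Or.inr rfl)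
  obtain ⟨ACAB, hACABd, hACABi⟩ : ∃ T : IntegralRep 4, T.domain = {t | 0 < t 3 ∧ t 3 < t 2 ∧ t 2 < t 1 ∧ t 1 < t 0 ∧ t 0 < 1} ∧
      (T.integrand = fun t => 1 / t 0 * (1 / (1 + t 1)) * (1 / t 2) * (1 / (1 - t 3))) :=
    m4_exists_wordRep4 (fun u => 1 / u) (fun u => 1 / (1 + u)) (fun u => 1 / u) (fun u => 1 / (1 - u)) (Or.inl rfl) (Or.inr (Or.inr rfl)) (Or.inl rfl) (Or.inl rfl)
  obtain ⟨ACAC, hACACd, hACACi⟩ : ∃ T : IntegralRep 4, T.domain = {t | 0 < t 3 ∧ t 3 < t 2 ∧ t 2 < t 1 ∧ t 1 < t 0 ∧ t 0 < 1} ∧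
      (T.integrand = fun t => 1 / t 0 * (1 / (1 + t 1)) * (1 / t 2) * (1 / (1 + t 3))) :=
    m4_exists_wordRep4 (fun u => 1 / u) (fun u => 1 / (1 + u)) (fun u => 1 / u) (fun u => 1 / (1 + u)) (Or.inl rfl) (Or.inr (Or.inr rfl)) (Or.inl rfl) (Or.inr rfl)
  obtain ⟨CAAB, hCAABd, hCAABi⟩ : ∃ T : IntegralRep 4, T.domain = {t | 0 < t 3 ∧ t 3 < t 2 ∧ t 2 < t 1 ∧ t 1 < t 0 ∧ t 0 < 1} ∧
      (T.integrand = fun t => 1 / (1 + t 0) * (1 / t 1) * (1 / t 2) * (1 / (1 - t 3))) :=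
    m4_exists_wordRep4 (fun u => 1 / (1 + u)) (fun u => 1 / u) (fun u => 1 / u) (fun u => 1 / (1 - u)) (Or.inr rfl) (Or.inl rfl) (Or.inl rfl) (Or.inl rfl)
  obtain ⟨CAAC, hCAACd, hCAACi⟩ : ∃ T : IntegralRep 4, T.domain = {t | 0 < t 3 ∧ t 3 < t 2 ∧ t 2 < t 1 ∧ t 1 < t 0 ∧ t 0 < 1} ∧
      (T.integrand = fun t => 1 / (1 + t 0) * (1 / t 1) * (1 / t 2) * (1 / (1 + t 3))) :=
    m4_exists_wordRep4 (fun u => 1 / (1 + u)) (fun u => 1 / u) (fun u => 1 / u) (fun u => 1 / (1 + u)) (Or.inr rfl) (Or.inl rfl) (Or.inl rfl) (Or.inr rfl)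
  -- the thirteen relations of the certificate
  obtain ⟨d1, d2, d3⟩ := m4_rel_dilations4 AAAB hAAABd hAAABi AAAC hAAACd hAAACi AABB hAABBd hAABBi AABC hAABCd hAABCi AACB hAACBd hAACBi AACC hAACCd hAACCi ABAB hABABd hABABi ABAC hABACd hABACi ACAB hACABd hACABi ACAC hACACd hACACi
  obtain ⟨s1, s2, s3, s4⟩ := m4_rel_shuffles4 C1 hC1d hC1i AB hABd hABi AC hACd hACi AAB hAABd hAABi
    AAC hAACd hAACi AABB hAABBd hAABBi ABAB hABABd hABABi AABC hAABCd hAABCi AACB hAACBd hAACBi ABAC hABACd hABACi ACAB hACABd hACABi CAAB hCAABd hCAABi AACC hAACCd hAACCi ACAC hACACd hACACi CAAC hCAACd hCAACi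
  obtain ⟨p1, p2⟩ := m4_rel_pdil4 AB hABd hABi AC hACd hACi
  have b1 := m4_rel_bstuffle13p C1 hC1d hC1i AAC hAACd hAACi AAAB hAAABd hAAABi AACB hAACBd hAACBi CAAB hCAABd hCAABi
  have b2 := m4_rel_bstuffle13m C1 hC1d hC1i AAB hAABd hAABi AAAC hAAACd hAAACi AABC hAABCd hAABCi CAAC hCAACd hCAACi
  have b3 := m4_rel_bstuffle22pm AB hABd hABi AC hACd hACi AAAC hAAACd hAAACi ABAC hABACd hABACi ACAC hACACd hACACi
  have b4 := m4_rel_bstuffle22pp AC hACd hACi AAAB hAAABd hAAABi ACAB hACABd hACABi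
  -- the certificate: `12·(2[aaac] − [aaab] − [abab])` is an integer combination of the rows
  have cert : (12:ℕ) • ((2:ℕ) • of AAAC - of AAAB - of ABAB) ∈ relations := by
    have e : (12:ℕ) • ((2:ℕ) • of AAAC - of AAAB - of ABAB) =
        (-24:ℤ) • (of (C1.prod AAC) - of AAAB + of AACB + of CAAB) +
        (24:ℤ) • (of (C1.prod AAB) - of AAAC - of AABC + of CAAC) +
        (16:ℤ) • (of (AB.prod AC) - of AAAC - of ABAC + of ACAC) +
        (-20:ℤ) • (of (AC.prod AC) - of AAAB + (2:ℤ) • of ACAB) +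
        (-12:ℤ) • ((4:ℤ) • of AABC + (4:ℤ) • of AACB - (4:ℤ) • of AACC - (3:ℤ) • of AABB) +
        (-2:ℤ) • ((4:ℤ) • of ABAC + (4:ℤ) • of ACAB - (4:ℤ) • of ACAC - (3:ℤ) • of ABAB) +
        (-24:ℤ) • (of (AB.prod AC) - (2:ℤ) • of AABC - (2:ℤ) • of AACB - of ABAC - of ACAB) +
        (-24:ℤ) • (of (C1.prod AAB) - of AABC - of AACB - of ACAB - of CAAB) +
        (8:ℤ) • ((8:ℤ) • of AAAC - (7:ℤ) • of AAAB) +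
        (24:ℤ) • (of (C1.prod AAC) - (2:ℤ) • of AACC - of ACAC - of CAAC) +
        (9:ℤ) • (of (AB.prod AB) - (4:ℤ) • of AABB - (2:ℤ) • of ABAB) +
        (9:ℤ) • ((2:ℤ) • of (AB.prod AC) - of (AB.prod AB)) +
        (10:ℤ) • ((2:ℤ) • of (AC.prod AC) - of (AB.prod AC)) := by
      simp only [smul_sub, smul_add, smul_smul]
      norm_num
      abel
    rw [e]
    refine relations.add_mem (relations.add_mem (relations.add_mem (relations.add_mem
      (relations.add_mem (relations.add_mem (relations.add_mem (relations.add_mem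
      (relations.add_mem (relations.add_mem (relations.add_mem (relations.add_mem
      (relations.zsmul_mem b1 _) (relations.zsmul_mem b2 _)) (relations.zsmul_mem b3 _))
      (relations.zsmul_mem b4 _)) (relations.zsmul_mem d2 _)) (relations.zsmul_mem d3 _))
      (relations.zsmul_mem s1 _)) (relations.zsmul_mem s2 _)) (relations.zsmul_mem d1 _))
      (relations.zsmul_mem s3 _)) (relations.zsmul_mem s4 _)) (relations.zsmul_mem p1 _))
      (relations.zsmul_mem p2 _)
  -- the left side: `[r] = 2[aaac]` (cubical chart onto `2·AAAC`, then the scaling)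
  have hΔpos : ∀ t ∈ {t : Fin 4 → ℝ | 0 < t 3 ∧ t 3 < t 2 ∧ t 2 < t 1 ∧ t 1 < t 0 ∧ t 0 < 1},
      0 < t 0 ∧ 0 < t 1 ∧ t 1 < 1 ∧ 0 < t 2 ∧ t 3 < 1 ∧ 0 < 1 + t 3 := fun t ht => by
    obtain ⟨h3, h32, h21, h10, h0⟩ := ht
    exact ⟨by linarith, by linarith, by linarith, by linarith, by linarith, by linarith⟩
  have hbox : ∀ x ∈ {x : Fin 4 → ℝ | ∀ i, x i ∈ Set.Ioo (0:ℝ) 1},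
      0 < x 0 ∧ 0 < x 1 ∧ 0 < x 2 ∧ 0 < x 3 ∧ x 0 * x 1 < 1 ∧ x 0 * x 1 * x 2 * x 3 < 1 := by
    intro x hx
    have h01 : x 0 * x 1 < 1 := mul_lt_one_of_nonneg_of_lt_one_left (hx 0).1.le (hx 0).2 (hx 1).2.le
    have h012 : x 0 * x 1 * x 2 < 1 :=
      mul_lt_one_of_nonneg_of_lt_one_left (mul_pos (hx 0).1 (hx 1).1).le h01 (hx 2).2.le
    exact ⟨(hx 0).1, (hx 1).1, (hx 2).1, (hx 3).1, h01, mul_lt_one_of_nonneg_of_lt_one_left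
      (mul_pos (mul_pos (hx 0).1 (hx 1).1) (hx 2).1).le h012 (hx 3).2.le⟩
  set T2A : IntegralRep 4 := AAAC.constMul ((2:ℕ):ℝ) (isAlgebraic_nat 2) with hT2A
  have cr1 : of r - of T2A ∈ relations := by
    refine m4_box_sub_simplex4.1
      (fun t => ((2:ℕ):ℝ) * (1 / t 0 * (1 / t 1) * (1 / t 2) * (1 / (1 + t 3)))) r T2A hrd
      (by rw [hT2A, IntegralRep.domain_constMul, hAAACd])
      (fun t _ => by rw [hT2A, IntegralRep.integrand_constMul, hAAACi]) fun x hx => ?_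
    rw [hrd] at hx
    obtain ⟨h0, h1, h2, h3, -, hP⟩ := hbox x hx
    rw [hri (hrd ▸ hx)]
    simp only [Matrix.cons_val_zero, Matrix.cons_val_one, Matrix.head_cons, Matrix.cons_val_two,
      Matrix.tail_cons, Matrix.cons_val_three]
    push_cast
    field_simp
  have cr2 : of T2A - (2:ℕ) • of AAAC ∈ relations :=
    IntegralRep.of_constMul_nat_sub_nsmul_mem_relations AAAC 2
  -- the right side: `[r'] = [aaab] + [abab]` (cubical chart onto a carrier of
  -- `1/(t₀ t₁ (1−t₁) t₂ (1−t₃))`, then the split `1/(t₁(1−t₁)) = 1/t₁ + 1/(1−t₁)`)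
  have hIa : IntegrableOn (fun t : Fin 4 → ℝ => 1 / t 0 * (1 / t 1) * (1 / t 2) * (1 / (1 - t 3)))
      {t : Fin 4 → ℝ | 0 < t 3 ∧ t 3 < t 2 ∧ t 2 < t 1 ∧ t 1 < t 0 ∧ t 0 < 1} := by
    have h := AAAB.integrableOn
    rw [hAAABd, hAAABi] at h
    exact h
  have hIb : IntegrableOn (fun t : Fin 4 → ℝ => 1 / t 0 * (1 / (1 - t 1)) * (1 / t 2) * (1 / (1 - t 3)))
      {t : Fin 4 → ℝ | 0 < t 3 ∧ t 3 < t 2 ∧ t 2 < t 1 ∧ t 1 < t 0 ∧ t 0 < 1} := by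
    have h := ABAB.integrableOn
    rw [hABABd, hABABi] at h
    exact h
  have hFG : ∀ t ∈ {t : Fin 4 → ℝ | 0 < t 3 ∧ t 3 < t 2 ∧ t 2 < t 1 ∧ t 1 < t 0 ∧ t 0 < 1},
      1 / (t 0 * t 1 * (1 - t 1) * t 2 * (1 - t 3)) =
        1 / t 0 * (1 / t 1) * (1 / t 2) * (1 / (1 - t 3)) +
          1 / t 0 * (1 / (1 - t 1)) * (1 / t 2) * (1 / (1 - t 3)) := fun t ht => by
    obtain ⟨h0, h1, h11, h2, h31, -⟩ := hΔpos t ht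
    have h1' : 1 - t 1 ≠ 0 := by linarith
    have h3' : 1 - t 3 ≠ 0 := by linarith
    field_simp
    ring
  obtain ⟨VB, hVBd, hVBi⟩ : ∃ T : IntegralRep 4,
      T.domain = {t | 0 < t 3 ∧ t 3 < t 2 ∧ t 2 < t 1 ∧ t 1 < t 0 ∧ t 0 < 1} ∧
      T.integrand = fun t => 1 / (t 0 * t 1 * (1 - t 1) * t 2 * (1 - t 3)) := by
    have hq : ∀ t ∈ {t : Fin 4 → ℝ | 0 < t 3 ∧ t 3 < t 2 ∧ t 2 < t 1 ∧ t 1 < t 0 ∧ t 0 < 1},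
        (MvPolynomial.aeval t (MvPolynomial.X 0 * MvPolynomial.X 1 * (1 - MvPolynomial.X 1) *
          MvPolynomial.X 2 * (1 - MvPolynomial.X 3) : MvPolynomial (Fin 4) ℚ) : ℝ) ≠ 0 := by
      intro t ht
      obtain ⟨h0, h1, h11, h2, h31, -⟩ := hΔpos t ht
      simp only [map_mul, map_sub, map_one, MvPolynomial.aeval_X]
      have : 0 < 1 - t 1 := by linarith
      have : 0 < 1 - t 3 := by linarith
      positivity
    refine m4s_exists_rep_of_abs_le ((isSemialgebraicFunOn_aeval_div_aeval
      m4s_isSemialgebraic_simplex4 1 _ hq).congr fun t _ => by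
        simp only [map_mul, map_sub, map_one, MvPolynomial.aeval_X]) ?_ (hIa.add hIb)
      fun t ht => ?_
    · exact continuousOn_const.div (by fun_prop) fun t ht => by
        obtain ⟨h0, h1, h11, h2, h31, -⟩ := hΔpos t ht
        have : 0 < 1 - t 1 := by linarith
        have : 0 < 1 - t 3 := by linarith
        positivity
    · obtain ⟨h0, h1, h11, h2, h31, -⟩ := hΔpos t ht
      have : 0 < 1 - t 1 := by linarith
      have : 0 < 1 - t 3 := by linarith
      rw [Pi.add_apply, hFG t ht, abs_of_pos (by positivity)]
  have cr'1 : of r' - of VB ∈ relations := by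
    refine m4_box_sub_simplex4.1 (fun t => 1 / (t 0 * t 1 * (1 - t 1) * t 2 * (1 - t 3))) r' VB
      hr'd hVBd (hVBi ▸ fun _ _ => rfl) fun x hx => ?_
    rw [hr'd] at hx
    obtain ⟨h0, h1, h2, h3, h01, hP⟩ := hbox x hx
    rw [hr'i (hr'd ▸ hx)]
    simp only [Matrix.cons_val_zero, Matrix.cons_val_one, Matrix.head_cons, Matrix.cons_val_two,
      Matrix.tail_cons, Matrix.cons_val_three]
    have h01' : 1 - x 0 * x 1 ≠ 0 := by linarith
    have hP' : 1 - x 0 * x 1 * x 2 * x 3 ≠ 0 := by linarith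
    field_simp
  have cr'2 : of VB - ((1:ℤ) • of AAAB + (1:ℤ) • of ABAB) ∈ relations := by
    have h := aff_orbit_of_sub_sum_zsmul_mem_relations (Finset.univ : Finset (Fin 2))
      ![AAAB, ABAB] ![1, 1] VB (fun i _ => by
        fin_cases i
        · exact hAAABd.trans hVBd.symm
        · exact hABABd.trans hVBd.symm) fun t ht => ?_
    · simpa [Fin.sum_univ_two] using h
    rw [hVBi]
    simp only [Fin.sum_univ_two, Matrix.cons_val_zero, Matrix.cons_val_one, hAAABi, hABABi]
    push_cast
    rw [one_mul, one_mul]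
    exact hFG t (hVBd ▸ ht)
  -- `12·([r] − [r']) ∈ relations`, then divide by `12`
  have h12 : (12:ℕ) • (of r - of r') ∈ relations := by
    have e : (12:ℕ) • (of r - of r') =
        (12:ℕ) • ((of r - of T2A) + (of T2A - (2:ℕ) • of AAAC)) -
          (12:ℕ) • ((of r' - of VB) + (of VB - ((1:ℤ) • of AAAB + (1:ℤ) • of ABAB))) +
          (12:ℕ) • ((2:ℕ) • of AAAC - of AAAB - of ABAB) := by
      simp only [one_smul, smul_sub, smul_add]
      abel
    rw [e]
    exact relations.add_mem (relations.sub_mem (relations.nsmul_mem (relations.add_mem cr1 cr2) _)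
      (relations.nsmul_mem (relations.add_mem cr'1 cr'2) _)) cert
  exact Summit.KontsevichZagierPeriods.MzvKernelInKZ.Negative.mem_relations_of_nsmul_mem
    (by norm_num) h12

end Summit.KontsevichZagierPeriods.HurwitzMicroSectors.NormalFormPrinciple.PiBox.M3
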